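import Summits.Parity.BatemanHorn.Theorems.SelbergDelangeRigidityLSDRealSegmentTypeILocal
import Summits.Parity.BatemanHorn.Theorems.SelbergDelangeRigidityLSDRealSegmentTypeISandwich
import Summits.Parity.BatemanHorn.Theorems.SelbergDelangeRigidityLSDRealSegmentTypeILevinFainleib
import HarnessLib

/-!
# Route `SelbergDelangeRigidity`, crux `LSDRealSegment` (stmt-Parity-9770), line
# `product-anatomy-subcritical`: the registered stub `stub_typeI` (the level-`x` half `T_x(y)`)

For a Bateman–Horn system `f = (f₁, …, f_k)` and real `1 < y < 2`:
`x⁻¹ (log x)^{k(1−y)} T_x(y) → λ_F(y) / Γ(k(y−1)+1)` (`TypeILawOmega k f y`), where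
`T_x(y) = typeISum f y x = Σ_{n ≤ x} Σ_{d ∣ P(n), d ≤ x} g_y(d)` and `λ_F = eulerFactor f`.

Proof.  With `b(m) = g_y(m) ρ_F(m)/m` and `κ = k(y−1)`:
1. `typeI_sandwich` (`…TypeISandwich.lean`): `T_x = x G(x) + O(1 + H(x))`, `G(x) = Σ_{m ≤ x} b(m)`,
   `H(x) = Σ_{m ≤ x} m b(m)`;
2. `typeI_local` (`…TypeILocal.lean`): `b` is non-negative multiplicative with prime mean `κ` (H1), prime-power
   control (H2) (this is where `y < 2` enters, at `p = 2`), and `Σ_ν b(p^ν) = E_p(y)`;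
3. `typeI_levinFainleib` (`…TypeILevinFainleib.lean`, Levin–Faĭnleĭb / Halberstam–Richert Lemma 5.4 through the
   PROVED Hardy–Littlewood–Karamata Tauberian theorem): `G(x) ~ (P/Γ(κ+1)) (log x)^κ` with
   `P = lim_N ∏_{p ≤ N} E_p(y)(1 − 1/p)^κ`;
4. here: the complex partial products `eulerPartial f N y` ARE these real products (`(1 − 1/p)^κ = e^{κ log(1−1/p)}`),
   so `λ_F(y) = P` (`Filter.Tendsto.limUnder_eq`); `H(x) = o(x (log x)^κ)` from the asymptotics of `G` alone
   (`H(x) ≤ (x/M) G(x) + x (G(x) − G(x/M))` for every `M`, and `(log (x/M))^κ ∼ (log x)^κ`); the normaliser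
   `x⁻¹ e^{k(1−y) log log x} = (x (log x)^κ)⁻¹` for `x ≥ 2`; cast `ℝ → ℂ` and `Γ(κ+1)` real (`Complex.Gamma_ofReal`).
-/

open Filter Finset Polynomial
open scoped BigOperators Topology Classical

namespace Summit.Parity.BatemanHorn.Cruxes.LSDRealSegment.ProductAnatomySubcritical

open Literature.NumberTheory.Sieve
open ArithmeticFunction (cardFactors)
noncomputable section

variable {k : ℕ}

/-! ### `Σ_{m ≤ x} m b(m) = o(x (log x)^κ)` from `Σ_{m ≤ x} b(m) ~ Λ (log x)^κ` -/

/-- If `b ≥ 0` and `Σ_{m ≤ x} b(m) / (log x)^κ → Λ` then `Σ_{m ≤ x} m b(m) / (x (log x)^κ) → 0`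
(split at `x/M`: `Σ m b(m) ≤ (x/M) G(x) + x (G(x) − G(x/M))`, and `(log(x/M)/log x)^κ → 1`). [folklore] -/
theorem tendsto_sum_mul_div_of_tendsto (b : ℕ → ℝ) (hb : ∀ m, 0 ≤ b m) (κ : ℝ) {Λ : ℝ}
    (hG : Tendsto (fun x : ℕ => (∑ m ∈ Icc 1 x, b m) / Real.log x ^ κ) atTop (𝓝 Λ)) :
    Tendsto (fun x : ℕ => (∑ m ∈ Icc 1 x, (m : ℝ) * b m) / ((x : ℝ) * Real.log x ^ κ)) atTop (𝓝 0) := by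
  obtain ⟨G, hGdef⟩ : ∃ G : ℕ → ℝ, ∀ x, G x = ∑ m ∈ Icc 1 x, b m := ⟨_, fun _ => rfl⟩
  obtain ⟨L, hLdef⟩ : ∃ L : ℕ → ℝ, ∀ x : ℕ, L x = Real.log x ^ κ := ⟨_, fun _ => rfl⟩
  simp only [← hGdef, ← hLdef] at hG ⊢
  have hG0 : ∀ x, 0 ≤ G x := fun x => by rw [hGdef]; exact Finset.sum_nonneg fun m _ => hb m
  have hGmono : ∀ u v, u ≤ v → G u ≤ G v := fun u v huv => by
    rw [hGdef, hGdef]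
    exact Finset.sum_le_sum_of_subset_of_nonneg (Finset.Icc_subset_Icc_right huv) fun m _ _ => hb m
  have hLpos : ∀ x : ℕ, 2 ≤ x → 0 < L x := fun x hx => by
    rw [hLdef]
    have hx2 : (2 : ℝ) ≤ x := by exact_mod_cast hx
    exact Real.rpow_pos_of_pos (Real.log_pos (by linarith)) κ
  rw [Metric.tendsto_nhds]
  intro ε hε
  -- the parameter `M`: `|Λ| / M < ε / 2`
  obtain ⟨M, hM1, hMε⟩ : ∃ M : ℕ, 1 ≤ M ∧ |Λ| / M < ε / 2 := by
    obtain ⟨M, hM⟩ := exists_nat_gt (2 * |Λ| / ε)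
    refine ⟨M + 1, by omega, ?_⟩
    have hM' : 2 * |Λ| / ε < ((M + 1 : ℕ) : ℝ) := hM.trans (by push_cast; linarith)
    rw [div_lt_iff₀ hε] at hM'
    rw [div_lt_iff₀ (by positivity)]
    push_cast at hM' ⊢
    nlinarith
  have hM0 : (0 : ℝ) < M := by exact_mod_cast hM1
  -- `u = x / M`
  have hu_le : ∀ x : ℕ, x / M ≤ x := fun x => Nat.div_le_self x M
  have hu_real : ∀ x : ℕ, ((x / M : ℕ) : ℝ) ≤ x / M := fun x => Nat.cast_div_le
  have hu_top : Tendsto (fun x : ℕ => x / M) atTop atTop := Nat.tendsto_div_const_atTop (by omega)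
  have hux : ∀ x : ℕ, 2 * M ≤ x → 2 ≤ x / M := fun x hx => (Nat.le_div_iff_mul_le hM1).mpr (by omega)
  -- `log (x/M) / log x → 1`
  have hlog : Tendsto (fun x : ℕ => Real.log ((x / M : ℕ) : ℝ) / Real.log x) atTop (𝓝 1) := by
    have hlim : Tendsto (fun x : ℕ => 1 - Real.log (2 * M) / Real.log x) atTop (𝓝 1) := by
      have h : Tendsto (fun x : ℕ => Real.log (2 * M) / Real.log x) atTop (𝓝 0) :=
        tendsto_const_nhds.div_atTop (Real.tendsto_log_atTop.comp tendsto_natCast_atTop_atTop)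
      simpa using (tendsto_const_nhds (x := (1 : ℝ))).sub h
    refine tendsto_of_tendsto_of_tendsto_of_le_of_le' hlim tendsto_const_nhds ?_ ?_
    · filter_upwards [eventually_ge_atTop (2 * M)] with x hx
      have hu2 := hux x hx
      have hx2 : (2 : ℝ) ≤ x := by exact_mod_cast le_trans (by omega : 2 ≤ 2 * M) hx
      have hlogx : 0 < Real.log x := Real.log_pos (by linarith)
      have hu0 : (0 : ℝ) < ((x / M : ℕ) : ℝ) := by exact_mod_cast (by omega : 0 < x / M)
      have h1 : (x : ℝ) ≤ 2 * M * ((x / M : ℕ) : ℝ) := by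
        have h := Nat.lt_div_mul_add (a := x) hM1
        have h' : x ≤ 2 * M * (x / M) := by nlinarith
        exact_mod_cast h'
      have h2 : Real.log x ≤ Real.log (2 * M) + Real.log ((x / M : ℕ) : ℝ) := by
        rw [← Real.log_mul (by positivity) hu0.ne']
        exact Real.log_le_log (by positivity) h1
      rw [sub_le_iff_le_add, ← add_div, le_div_iff₀ hlogx, one_mul]
      linarith
    · filter_upwards [eventually_ge_atTop (2 * M)] with x hx
      have hu2 := hux x hx
      have hx2 : (2 : ℝ) ≤ x := by exact_mod_cast le_trans (by omega : 2 ≤ 2 * M) hx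
      have hlogx : 0 < Real.log x := Real.log_pos (by linarith)
      rw [div_le_one hlogx]
      exact Real.log_le_log (by exact_mod_cast (by omega : 0 < x / M)) (by exact_mod_cast hu_le x)
  -- `L (x/M) / L x → 1`
  have hLratio : Tendsto (fun x : ℕ => L (x / M) / L x) atTop (𝓝 1) := by
    have h1 := hlog.rpow_const (p := κ) (Or.inl one_ne_zero)
    rw [Real.one_rpow] at h1
    refine h1.congr' ?_
    filter_upwards [eventually_ge_atTop (2 * M)] with x hx
    have hx1 : (1 : ℝ) ≤ x := by exact_mod_cast le_trans (by omega : 1 ≤ 2 * M) hx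
    have hu1 : (1 : ℝ) ≤ ((x / M : ℕ) : ℝ) := by exact_mod_cast le_trans (by norm_num : 1 ≤ 2) (hux x hx)
    rw [hLdef, hLdef, Real.div_rpow (Real.log_nonneg hu1) (Real.log_nonneg hx1)]
  -- `G (x/M) / L x → Λ`
  have hGu : Tendsto (fun x : ℕ => G (x / M) / L x) atTop (𝓝 Λ) := by
    have h1 : Tendsto (fun x : ℕ => G (x / M) / L (x / M)) atTop (𝓝 Λ) := hG.comp hu_top
    have h2 := h1.mul hLratio
    rw [mul_one] at h2
    refine h2.congr' ?_
    filter_upwards [eventually_ge_atTop (2 * M)] with x hx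
    have hLu : L (x / M) ≠ 0 := (hLpos _ (hux x hx)).ne'
    have hLx : L x ≠ 0 := (hLpos x (le_trans (by omega) hx)).ne'
    field_simp
  -- the majorant tends to `Λ / M < ε`
  have hB : Tendsto (fun x : ℕ => G x / L x / M + (G x / L x - G (x / M) / L x)) atTop
      (𝓝 (Λ / M + (Λ - Λ))) :=
    (hG.div_const _).add (hG.sub hGu)
  rw [sub_self, add_zero] at hB
  have hΛM : Λ / M < ε := by
    have h1 : Λ / M ≤ |Λ| / M := div_le_div_of_nonneg_right (le_abs_self Λ) hM0.le
    linarith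
  filter_upwards [hB.eventually_lt_const hΛM, eventually_ge_atTop (2 * M)] with x hBx hx
  have hx2 : 2 ≤ x := le_trans (by omega) hx
  have hx0 : (0 : ℝ) < x := by exact_mod_cast (by omega : 0 < x)
  have hLx : 0 < L x := hLpos x hx2
  have hH0 : 0 ≤ ∑ m ∈ Icc 1 x, (m : ℝ) * b m :=
    Finset.sum_nonneg fun m _ => mul_nonneg (Nat.cast_nonneg _) (hb m)
  rw [Real.dist_eq, sub_zero, abs_of_nonneg (div_nonneg hH0 (mul_pos hx0 hLx).le)]
  refine lt_of_le_of_lt ?_ hBx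
  -- `H(x) ≤ (x/M) G(x/M) + x (G x - G (x/M)) ≤ (x/M) G x + x (G x - G (x/M))`
  have hIcc : ∀ n : ℕ, Icc 1 n = Ioc 0 n := fun n => by
    ext m
    simp only [Finset.mem_Icc, Finset.mem_Ioc]
    omega
  have hGdiff : G x - G (x / M) = ∑ m ∈ Ioc (x / M) x, b m := by
    rw [hGdef, hGdef, hIcc, hIcc, ← Finset.sum_Ioc_consecutive _ (Nat.zero_le (x / M)) (hu_le x)]
    ring
  have hsplit : ∑ m ∈ Icc 1 x, (m : ℝ) * b m ≤ (x : ℝ) / M * G x + x * (G x - G (x / M)) := by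
    rw [hIcc, ← Finset.sum_Ioc_consecutive _ (Nat.zero_le (x / M)) (hu_le x), hGdiff]
    refine add_le_add ?_ ?_
    · calc ∑ m ∈ Ioc 0 (x / M), (m : ℝ) * b m ≤ ∑ m ∈ Ioc 0 (x / M), ((x / M : ℕ) : ℝ) * b m :=
            Finset.sum_le_sum fun m hm => mul_le_mul_of_nonneg_right
              (by exact_mod_cast (Finset.mem_Ioc.mp hm).2) (hb m)
        _ = ((x / M : ℕ) : ℝ) * G (x / M) := by rw [hGdef, hIcc, Finset.mul_sum]
        _ ≤ (x : ℝ) / M * G x := mul_le_mul (hu_real x) (hGmono _ _ (hu_le x)) (hG0 _) (by positivity)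
    · rw [Finset.mul_sum]
      exact Finset.sum_le_sum fun m hm => mul_le_mul_of_nonneg_right
        (by exact_mod_cast (Finset.mem_Ioc.mp hm).2) (hb m)
  have hx0' : (x : ℝ) ≠ 0 := hx0.ne'
  have hLx' : L x ≠ 0 := hLx.ne'
  have hM0' : (M : ℝ) ≠ 0 := hM0.ne'
  calc (∑ m ∈ Icc 1 x, (m : ℝ) * b m) / ((x : ℝ) * L x)
      ≤ ((x : ℝ) / M * G x + x * (G x - G (x / M))) / ((x : ℝ) * L x) :=
        div_le_div_of_nonneg_right hsplit (mul_pos hx0 hLx).le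
    _ = G x / L x / M + (G x / L x - G (x / M) / L x) := by
        field_simp

/-! ### The constant: `λ_F(y)` is the real Levin–Faĭnleĭb product -/

/-- At the real point `y` the complex partial products of `λ_F` are the real products
`∏_{p ≤ N} (Σ_ν b(p^ν)) (1 − 1/p)^{k(y−1)}` cast to `ℂ`. [folklore] -/
theorem eulerPartial_ofReal_eq {f : Fin k → ℤ[X]} {y : ℝ} {g : ℕ → ℝ}
    (hloc : ∀ p : ℕ, p.Prime → (((∑' ν : ℕ, g (p ^ ν) : ℝ) : ℂ) = localFactor f p (y : ℂ))) (N : ℕ) :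
    eulerPartial f N (y : ℂ) =
      ((∏ p ∈ Nat.primesLE N, (∑' ν : ℕ, g (p ^ ν)) * (1 - 1 / (p : ℝ)) ^ ((k : ℝ) * (y - 1)) : ℝ) : ℂ) := by
  unfold eulerPartial
  rw [Complex.ofReal_prod]
  refine Finset.prod_congr rfl fun p hp => ?_
  have hp' := Nat.prime_of_mem_primesLE hp
  have hc : (0 : ℝ) < 1 - 1 / (p : ℝ) := by
    have h2 : (2 : ℝ) ≤ p := by exact_mod_cast hp'.two_le
    rw [sub_pos, div_lt_one (by linarith)]
    linarith
  rw [Complex.ofReal_mul, hloc p hp', Real.rpow_def_of_pos hc, Complex.ofReal_exp]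
  congr 2
  push_cast
  ring

/-- Hence `λ_F(y) = eulerFactor f y` IS the limit `P` of the real products. [folklore] -/
theorem eulerFactor_ofReal_eq {f : Fin k → ℤ[X]} {y : ℝ} {g : ℕ → ℝ}
    (hloc : ∀ p : ℕ, p.Prime → (((∑' ν : ℕ, g (p ^ ν) : ℝ) : ℂ) = localFactor f p (y : ℂ))) {P : ℝ}
    (hP : Tendsto (fun N : ℕ => ∏ p ∈ Nat.primesLE N,
      (∑' ν : ℕ, g (p ^ ν)) * (1 - 1 / (p : ℝ)) ^ ((k : ℝ) * (y - 1))) atTop (𝓝 P)) :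
    eulerFactor f (y : ℂ) = (P : ℂ) := by
  unfold eulerFactor
  have h : Tendsto (fun N : ℕ => eulerPartial f N (y : ℂ)) atTop (𝓝 (P : ℂ)) := by
    refine ((Complex.continuous_ofReal.tendsto P).comp hP).congr fun N => ?_
    rw [Function.comp_apply, eulerPartial_ofReal_eq hloc N]
  exact h.limUnder_eq

/-- The crux normaliser at real `y`: `x⁻¹ e^{k(1−y) log log x} = (x (log x)^{k(y−1)})⁻¹` for `x ≥ 2`. [folklore] -/
theorem normaliser_ofReal_eq (k : ℕ) (y : ℝ) {x : ℕ} (hx : 2 ≤ x) :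
    (x : ℂ)⁻¹ * Complex.exp ((k : ℂ) * (1 - (y : ℂ)) * (Real.log (Real.log x) : ℂ)) =
      ((((x : ℝ) * Real.log x ^ ((k : ℝ) * (y - 1)))⁻¹ : ℝ) : ℂ) := by
  have hx2 : (2 : ℝ) ≤ x := by exact_mod_cast hx
  have hlog : 0 < Real.log x := Real.log_pos (by linarith)
  have h1 : Complex.exp ((k : ℂ) * (1 - (y : ℂ)) * (Real.log (Real.log x) : ℂ)) =
      ((Real.log x ^ ((k : ℝ) * (1 - y)) : ℝ) : ℂ) := by
    rw [Real.rpow_def_of_pos hlog, Complex.ofReal_exp]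
    congr 1
    push_cast
    ring
  rw [h1, show (k : ℝ) * (1 - y) = -((k : ℝ) * (y - 1)) by ring, Real.rpow_neg hlog.le]
  push_cast
  ring

/-! ### The registered stub -/

/-- **stub_typeI** (registered stub of the checked skeleton of line `product-anatomy-subcritical`): for every
Bateman–Horn system `f` and every real `1 < y < 2`, the level-`x` half of the real-segment law
`x⁻¹ (log x)^{k(1−y)} T_x(y) → λ_F(y) / Γ(k(y−1)+1)` (`TypeILawOmega k f y`): sandwich `T_x = xG(x) + O(1 + H(x))`,
Levin–Faĭnleĭb for the non-negative multiplicative coefficient `b = g_y ρ_F / id` of prime mean `k(y−1)` (the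
un-capped weight needs `y < 2` at `p = 2`), identification of the Levin–Faĭnleĭb constant with the line's
explicit `λ_F(y) = eulerFactor f y`, and `H(x) = o(x (log x)^{k(y−1)})`. [folklore] -/
theorem stub_typeI : ∀ (k : ℕ) (f : Fin k → ℤ[X]), IsBatemanHornSystem f → ∀ y : ℝ, 1 < y → y < 2 →
    TypeILawOmega k f y := by
  intro k f hf y hy1 hy2
  have hy : 1 ≤ y := hy1.le
  have hκ0 : 0 ≤ (k : ℝ) * (y - 1) := mul_nonneg (Nat.cast_nonneg _) (by linarith)
  -- the coefficient `b` and its mean value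
  obtain ⟨g, hg⟩ : ∃ g : ℕ → ℝ, ∀ m, g m = omegaWeight y m * (polyRootCountMod f m : ℝ) / m :=
    ⟨_, fun _ => rfl⟩
  obtain ⟨hg0, hg1, hgmul, hH1, hH2, hloc⟩ := typeI_local k f hf y hy hy2 g hg
  obtain ⟨P, -, hprod, hG⟩ := typeI_levinFainleib g ((k : ℝ) * (y - 1)) hκ0 hg0 hg1 hgmul hH1 hH2
  obtain ⟨C, hC⟩ := typeI_sandwich k f hf y hy
  have hEuler : eulerFactor f (y : ℂ) = (P : ℂ) := eulerFactor_ofReal_eq (fun p hp => (hloc p hp).2) hprod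
  -- the sandwich in terms of `g`: `H(x) = Σ_{m ≤ x} m g(m)`
  have hHeq : ∀ x, ∑ m ∈ Icc 1 x, omegaWeight y m * (polyRootCountMod f m : ℝ) =
      ∑ m ∈ Icc 1 x, (m : ℝ) * g m := by
    intro x
    refine Finset.sum_congr rfl fun m hm => ?_
    have hm0 : (m : ℝ) ≠ 0 := by
      have := (Finset.mem_Icc.mp hm).1
      exact_mod_cast (show m ≠ 0 by omega)
    rw [hg]
    field_simp
  have hC' : ∀ x, |typeISum f y x - x * ∑ m ∈ Icc 1 x, g m| ≤ C * (1 + ∑ m ∈ Icc 1 x, (m : ℝ) * g m) := by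
    intro x
    have h := hC x
    simp only [← hg, hHeq] at h
    exact h
  set κ : ℝ := (k : ℝ) * (y - 1) with hκ
  -- `H(x) = o(x (log x)^κ)` and `1 = o(x (log x)^κ)`
  have hHlim := tendsto_sum_mul_div_of_tendsto g hg0 κ hG
  have h1x : Tendsto (fun x : ℕ => 1 / ((x : ℝ) * Real.log x ^ κ)) atTop (𝓝 0) := by
    refine tendsto_of_tendsto_of_tendsto_of_le_of_le' tendsto_const_nhds tendsto_one_div_atTop_nhds_zero_nat
      ?_ ?_
    · filter_upwards [eventually_ge_atTop 3] with x hx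
      have hx3 : (3 : ℝ) ≤ x := by exact_mod_cast hx
      exact div_nonneg zero_le_one (mul_nonneg (by linarith) (Real.rpow_nonneg (Real.log_nonneg (by linarith)) _))
    · filter_upwards [eventually_ge_atTop 3] with x hx
      have hx3 : (3 : ℝ) ≤ x := by exact_mod_cast hx
      have hx0 : (0 : ℝ) < x := by linarith
      have hlog1 : 1 ≤ Real.log x := by
        rw [Real.le_log_iff_exp_le hx0]
        exact Real.exp_one_lt_three.le.trans hx3
      exact one_div_le_one_div_of_le hx0 (le_mul_of_one_le_right hx0.le (Real.one_le_rpow hlog1 hκ0))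
  -- the error of the sandwich is `o(x (log x)^κ)`
  have hErr : Tendsto (fun x : ℕ => (typeISum f y x - x * ∑ m ∈ Icc 1 x, g m) / ((x : ℝ) * Real.log x ^ κ))
      atTop (𝓝 0) := by
    have hmaj : Tendsto (fun x : ℕ => C * (1 / ((x : ℝ) * Real.log x ^ κ) +
        (∑ m ∈ Icc 1 x, (m : ℝ) * g m) / ((x : ℝ) * Real.log x ^ κ))) atTop (𝓝 (C * (0 + 0))) :=
      (h1x.add hHlim).const_mul C
    rw [add_zero, mul_zero] at hmaj
    refine squeeze_zero_norm' ?_ hmaj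
    filter_upwards [eventually_ge_atTop 2] with x hx
    have hx2 : (2 : ℝ) ≤ x := by exact_mod_cast hx
    have hx0 : (0 : ℝ) < x := by linarith
    have hL : 0 < Real.log x ^ κ := Real.rpow_pos_of_pos (Real.log_pos (by linarith)) κ
    rw [Real.norm_eq_abs, abs_div, abs_of_pos (mul_pos hx0 hL), ← add_div, mul_div_assoc']
    exact div_le_div_of_nonneg_right (hC' x) (mul_pos hx0 hL).le
  -- the real limit `T_x / (x (log x)^κ) → P / Γ(κ+1)`
  have hreal : Tendsto (fun x : ℕ => typeISum f y x / ((x : ℝ) * Real.log x ^ κ)) atTop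
      (𝓝 (P / Real.Gamma (κ + 1))) := by
    have h := hG.add hErr
    rw [add_zero] at h
    refine h.congr' ?_
    filter_upwards [eventually_ge_atTop 2] with x hx
    have hx2 : (2 : ℝ) ≤ x := by exact_mod_cast hx
    have hx0 : (x : ℝ) ≠ 0 := by positivity
    have hL : Real.log x ^ κ ≠ 0 := (Real.rpow_pos_of_pos (Real.log_pos (by linarith)) κ).ne'
    field_simp
    ring
  -- pass to `ℂ`
  unfold TypeILawOmega
  rw [hEuler, show (k : ℂ) * ((y : ℂ) - 1) + 1 = ((κ + 1 : ℝ) : ℂ) by rw [hκ]; push_cast; ring,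
    Complex.Gamma_ofReal]
  have hcplx := (Complex.continuous_ofReal.tendsto _).comp hreal
  rw [show (P : ℂ) * ((Real.Gamma (κ + 1) : ℝ) : ℂ)⁻¹ = ((P / Real.Gamma (κ + 1) : ℝ) : ℂ) by
    push_cast; ring]
  refine hcplx.congr' ?_
  filter_upwards [eventually_ge_atTop 2] with x hx
  rw [Function.comp_apply, normaliser_ofReal_eq k y hx]
  push_cast
  ring

end

end Summit.Parity.BatemanHorn.Cruxes.LSDRealSegment.ProductAnatomySubcritical
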